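import Summits.BirchSwinnertonDyer.BirchSwinnertonDyer.Theorems.ManinLocalTwoThreeTwistFamiliesFactFree
import Literature.NumberTheory.EllipticCurves.ManinConstantSemistablePrimewise
import Literature.NumberTheory.EllipticCurves.ManinConstantClassCertificateTwistGamma0Proofs
import Literature.NumberTheory.EllipticCurves.IsogenyConductorModularityProofs
import Literature.NumberTheory.EllipticCurves.IsogenyIdProofs
import Literature.NumberTheory.EllipticCurves.GlobalMinimalModelProofs
import Summits.BirchSwinnertonDyer.Rank1Residual.Additive.GordTwistMinimalModel
import Summits.BirchSwinnertonDyer.Rank1Residual.ManinAdditive.TwistOrbitDegreeIdentity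
import Summits.BirchSwinnertonDyer.BirchSwinnertonDyer.Theorems.ManinLocalTwoThreeSameLevelTwistTransport
import Summits.BirchSwinnertonDyer.BirchSwinnertonDyer.Theorems.ManinLocalTwoThreeLevelFreeTwistTransport
import Summits.BirchSwinnertonDyer.BirchSwinnertonDyer.Theorems.ManinLocalTwoThreeManinConstantEighty
import Summits.BirchSwinnertonDyer.BirchSwinnertonDyer.Theorems.ManinLocalTwoThreeManinConstantOneHundredEight
import Summits.BirchSwinnertonDyer.Rank1Residual.ManinAdditive.TowerUnitTwist
import Summits.BirchSwinnertonDyer.BirchSwinnertonDyer.Theorems.ManinLocalTwoThreeNeronSqueeze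
import Summits.BirchSwinnertonDyer.BirchSwinnertonDyer.Theorems.ManinLocalTwoThreeNeronSqueezeOneTwentyEightA
import Literature.NumberTheory.EllipticCurves.LocalReductionKrausMinimality
import Mathlib.Tactic.NormNum.Prime
import Literature.NumberTheory.EllipticCurves.IsogenyQuadraticTwistProofs
import Literature.NumberTheory.EllipticCurves.BSDSelmerCMPConverseMaximalOrderProofs
import Literature.NumberTheory.EllipticCurves.ManinConstantQuadraticTwistLimbProofs
import Literature.NumberTheory.EllipticCurves.ManinConstantClassCertificateTwist
import Literature.NumberTheory.EllipticCurves.LFunctionPrimeCoeffMultiplicative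
import Literature.NumberTheory.LFunctions.PrimitiveQuadraticCharacterGaussSum
import HarnessLib
import Summits.BirchSwinnertonDyer.BirchSwinnertonDyer.Theorems.ManinLocalTwoThreeAdditiveTwistFamiliesFactFree

/-!
# THE DEFECT LAW OF THE TWIST GROUPOID, part 1 of 4: the defect engines (cell bsd-f2-manin, desc g46 MEMO-desc §71, TURNKEY T-desc-58; landed by p1 gen 25)

Source `HOME/desc/g46/Sketch-desc-g46.lean` (1369 l., farm rc 0 · 0 sorries as a whole, 2026-08-31), split into four files ≤ 400 lines; §0's
`not_good_and_not_mult_of_isIsogenous` is IMPORTED from `…AdditiveTwistFamiliesFactFree` (T-desc-57), not restated.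
THE DEFECT LAW (71.A odd, 71.B dyadic): `A` with ANY `X₀(M)`-datum `D_A`; `C = u • (A ⊗ d)` globally minimal with `r¹² Δ(C) = d⁶ Δ(A)` (`r` = the
TWIST DEFECT: `±1` aligned, `±q` resp. `±2` down); `W'` globally minimal, ADDITIVE at the twisting prime, `W' ∼ A ⊗ d`, with a LATTICE-OPTIMAL
`X₀(N)`-datum `D'` (`M ∣ N`, `q² ∣ N`; dyadic: `4 ∣ N`, `M ∣ 2⁶N`) ⟹ `c(D') ∣ r · c(D_A)`; hence for a certified root `c(D') ∣ r`, so `ℓ ∤ c(D')` for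
every prime `ℓ ≠ q` REGARDLESS of alignment (the C2 shape along every odd twist, the C3 shape along every dyadic twist), and the dyadic
transports are LEVEL-FREE (p2's `maninLocalTwoThree_maninConstant_dvd_mul_of_additiveTwist_of_char_level`).  THIS PART: §0 integer/defect
bookkeeping (orientation lemma `|r₁ r₂| = |d|`), §1 the engines `maninConstant_dvd_mul_of_oddTwist_defect`, `…_of_twoTwist_additive_defect`,
`not_prime_dvd_maninConstant_of_oddTwist/twoTwist_additive`, `abs_maninConstant_eq_one_of_negOneTwist_additive_levelFree`.  All inputs PROVED in
the tree (no named fact).  HONEST SCOPE: per-class statements; C2, C3, Manin's conjecture and BSD are NOT proved.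
[cite: Stevens1989, Lemma (5.2) p. 96, Lemma (5.4) p. 97, (5.6)–(5.7) p. 98] [cite: Pal2012, Prop. 2.4, Lemma 3.1]
[cite: Connell1999, §5.7.3] [cite: SilvermanAEC2009, Cor. VII.7.2, §C.16] [cite: SilvermanATAEC1994, Cor. IV.9.1] [cite: EdixhovenManin1991, Prop. 2]
-/

set_option autoImplicit false
-- the summit-side namespace `Summit.BirchSwinnertonDyer.BirchSwinnertonDyer.…` is the tree's (summit = sub-problem)
set_option linter.dupNamespace false

noncomputable section

open scoped Classical NumberField MatrixGroups ModularForm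

namespace Summit.BirchSwinnertonDyer.BirchSwinnertonDyer.Theorems.ManinLocalTwoThree.TwistDefect

open WeierstrassCurve CongruenceSubgroup IsDedekindDomain IsDedekindDomain.HeightOneSpectrum Rat.HeightOneSpectrum
  Literature.NumberTheory.Automorphic Literature.NumberTheory.EllipticCurves Literature.NumberTheory.EllipticCurves.ModularForms
  Literature.NumberTheory.LFunctions.PrimitiveQuadratic Summit.BirchSwinnertonDyer.BirchSwinnertonDyer.Theorems
  Summit.BirchSwinnertonDyer.BirchSwinnertonDyer.Theorems.ManinLocalTwoThree Summit.BirchSwinnertonDyer.Rank1Residual.ManinAdditive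
  Summit.BirchSwinnertonDyer.BirchSwinnertonDyer.Theorems.ManinLocalTwoThree.TwistFamilies
  Summit.BirchSwinnertonDyer.BirchSwinnertonDyer.Theorems.ManinLocalTwoThree.AdditiveTwistFamilies

/-! ## §0 Integer bookkeeping and the fact-free inheritance of additivity -/

/-- `a ∣ r·c` with `|c| = 1` ⇒ `a ∣ r`. [folklore] -/
theorem dvd_of_dvd_mul_of_abs_eq_one {a r c : ℤ} (h : a ∣ r * c) (hc : |c| = 1) : a ∣ r :=
  ((Int.isUnit_iff_abs_eq.mpr hc).dvd_mul_right).mp h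

/-- `c ∣ q` (`q` prime) ⇒ `ℓ ∤ c` for every prime `ℓ ≠ q`. [folklore] -/
theorem not_prime_dvd_of_dvd_prime {c : ℤ} {q ℓ : ℕ} (hq : q.Prime) (hℓ : ℓ.Prime) (hne : ℓ ≠ q)
    (h : c ∣ (q : ℤ)) : ¬ (ℓ : ℤ) ∣ c := by
  intro hl
  have h1 : (ℓ : ℤ) ∣ (q : ℤ) := hl.trans h
  have h2 : ℓ ∣ q := Int.natCast_dvd_natCast.mp h1
  exact hne ((Nat.prime_dvd_prime_iff_eq hℓ hq).mp h2)

/-- `c ∣ q` (`q` prime) ⇒ `|c| = 1 ∨ |c| = q`: the two values of the Manin constant the defect law allows. [folklore] -/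
theorem abs_eq_one_or_eq_of_dvd_prime {c : ℤ} {q : ℕ} (hq : q.Prime) (h : c ∣ (q : ℤ)) :
    |c| = 1 ∨ |c| = q := by
  have h1 : c.natAbs ∣ q := by
    have := Int.natAbs_dvd_natAbs.mpr h
    simpa using this
  rcases (Nat.dvd_prime hq).mp h1 with h2 | h2
  · left; rw [Int.abs_eq_natAbs, h2, Nat.cast_one]
  · right; rw [Int.abs_eq_natAbs, h2]

/-- **THEOREM 71.E — THE ALIGNMENT BIT IS AN ORIENTATION OF THE TWIST GRAPH.**  If `C` is a minimal model
of `A ⊗ d` with defect `r₁` (`r₁¹² Δ(C) = d⁶ Δ(A)`) and `A` is a minimal model of `C ⊗ d` with defect `r₂`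
(`r₂¹² Δ(A) = d⁶ Δ(C)`), then `|r₁ r₂| = |d|`.  So for `|d| = q` prime EXACTLY ONE direction of every twist edge
is ALIGNED (`r = 1`, towards the larger `|Δ_min|`) and the other is DOWN (`r = q`); for `d = -1` both are aligned
(Connell–Pal).  Consequence (with 71.A/71.B): `|c| = 1` propagates fact-free UP the discriminant order from the
twist-minimal class of each orbit, and costs at most one factor `q` per DOWN edge. [elementary; cite: Pal2012, Prop. 2.4] -/
theorem abs_defect_mul_defect_eq {d r₁ r₂ : ℤ} {ΔA ΔC : ℚ} (hA : ΔA ≠ 0) (hd : d ≠ 0)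
    (h₁ : (r₁ : ℚ) ^ 12 * ΔC = (d : ℚ) ^ 6 * ΔA) (h₂ : (r₂ : ℚ) ^ 12 * ΔA = (d : ℚ) ^ 6 * ΔC) :
    |r₁ * r₂| = |d| := by
  have hdQ : (d : ℚ) ≠ 0 := by exact_mod_cast hd
  have hC : ΔC ≠ 0 := by
    intro hC
    rw [hC, mul_zero] at h₁
    exact mul_ne_zero (pow_ne_zero 6 hdQ) hA h₁.symm
  have e : ((r₁ : ℚ) * r₂) ^ 12 * (ΔA * ΔC) = (d : ℚ) ^ 12 * (ΔA * ΔC) := by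
    calc ((r₁ : ℚ) * r₂) ^ 12 * (ΔA * ΔC) = ((r₁ : ℚ) ^ 12 * ΔC) * ((r₂ : ℚ) ^ 12 * ΔA) := by ring
      _ = ((d : ℚ) ^ 6 * ΔA) * ((d : ℚ) ^ 6 * ΔC) := by rw [h₁, h₂]
      _ = (d : ℚ) ^ 12 * (ΔA * ΔC) := by ring
  have key : (r₁ * r₂) ^ 12 = d ^ 12 := by
    have := mul_right_cancel₀ (mul_ne_zero hA hC) e
    exact_mod_cast this
  rcases (pow_eq_pow_iff_of_ne_zero (by norm_num)).mp key with h | ⟨h, -⟩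
  · rw [h]
  · rw [h, abs_neg]

/-- 71.E for curves: `A` elliptic, `r₁¹² Δ(C) = d⁶ Δ(A)`, `r₂¹² Δ(A) = d⁶ Δ(C)` ⇒ `|r₁ r₂| = |d|`. -/
theorem abs_defect_mul_defect_eq_of_twist {A C : WeierstrassCurve ℚ} [A.IsElliptic] {d r₁ r₂ : ℤ}
    (hd : d ≠ 0) (h₁ : (r₁ : ℚ) ^ 12 * C.Δ = (d : ℚ) ^ 6 * A.Δ) (h₂ : (r₂ : ℚ) ^ 12 * A.Δ = (d : ℚ) ^ 6 * C.Δ) :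
    |r₁ * r₂| = |d| :=
  abs_defect_mul_defect_eq A.isUnit_Δ.ne_zero hd h₁ h₂

/-- 71.E, prime case: `|r₁ r₂| = q` prime ⇒ exactly one of `|r₁|`, `|r₂|` is `1` and the other is `q`. [elementary] -/
theorem abs_eq_one_and_abs_eq_or_of_abs_mul_eq_prime {q : ℕ} (hq : q.Prime) {r₁ r₂ : ℤ}
    (h : |r₁ * r₂| = q) : (|r₁| = 1 ∧ |r₂| = q) ∨ (|r₁| = q ∧ |r₂| = 1) := by
  have h' : r₁.natAbs * r₂.natAbs = q := by
    have e : ((r₁.natAbs * r₂.natAbs : ℕ) : ℤ) = (q : ℤ) := by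
      rw [Nat.cast_mul, Int.natCast_natAbs, Int.natCast_natAbs, ← abs_mul]; exact h
    exact_mod_cast e
  rcases (Nat.dvd_prime hq).mp (Dvd.intro _ h') with h1 | h1
  · left
    refine ⟨by rw [Int.abs_eq_natAbs, h1, Nat.cast_one], ?_⟩
    rw [h1, one_mul] at h'
    rw [Int.abs_eq_natAbs, h']
  · right
    refine ⟨by rw [Int.abs_eq_natAbs, h1], ?_⟩
    rw [h1] at h'
    have h2 : r₂.natAbs = 1 := by
      have : q * r₂.natAbs = q * 1 := by rw [mul_one]; exact h'
      exact Nat.eq_of_mul_eq_mul_left hq.pos this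
    rw [Int.abs_eq_natAbs, h2, Nat.cast_one]

/-! ## §1 THE DEFECT ENGINES -/

/-- **THEOREM 71.A — THE ODD DEFECT LAW `c(D) ∣ r · c(D')`, NO NAMED FACT.**  `q` an odd prime; `W` globally
minimal, ADDITIVE at `q`, with a lattice-optimal `X₀(N)`-datum `D`, `q² ∣ N`; `A` elliptic with ANY
`X₀(N')`-datum `D'`, `N' ∣ N`; `C = u • (A ⊗ q*)` globally minimal, isogenous to `W`, with TWIST DEFECT
`r`: `r¹² Δ(C) = (q*)⁶ Δ(A)`, `r ≠ 0`.  Then `c(D) ∣ r · c(D')`.  (`r = 1`: p2/p3's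
`maninLocalTwoThree_maninConstant_dvd_of_twist_pStar_aligned`; `r = q` at the conductor: clause 2 of an's
THEOREM A `twistOrbitManinTransport_pStar`; here generic `r` and generic levels, the root datum GIVEN.)
Chain: `aₙ(f_D) = χ_q(n) aₙ(f_{D'})` (`W` additive at `q`), `Λ_C = ± r g(χ_q)⁻¹ Λ_A`, `Γ₀` twist step.
[cite: Stevens1989, Lemma (5.2) p. 96, Lemma (5.4) p. 97] [cite: Pal2012, Lemma 3.1] [cite: SilvermanATAEC1994, Cor. IV.9.1] -/
theorem maninConstant_dvd_mul_of_oddTwist_defect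
    {q : ℕ} [Fact q.Prime] (hq2 : q ≠ 2)
    {W : WeierstrassCurve ℚ} [W.IsElliptic] [W.IsGloballyMinimal] {N : ℕ} [NeZero N]
    (D : ModularParametrizationData W N)
    (hopt : ∀ z ∈ D.L.lattice, ∃ w ∈ periodLattice D.f, z = D.c * w)
    {A : WeierstrassCurve ℚ} [A.IsElliptic] {N' : ℕ} [NeZero N'] (D' : ModularParametrizationData A N')
    (hN'N : N' ∣ N) (hqN : q ^ 2 ∣ N)
    (hadd : ¬ W.HasGoodReductionAtPrime q ∧ ¬ W.HasMultiplicativeReductionAtPrime q)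
    {C : WeierstrassCurve ℚ} [C.IsElliptic] [C.IsGloballyMinimal] (u : VariableChange ℚ)
    (hu : u • A.quadraticTwist (((-1 : ℤ) ^ (q / 2) * q : ℤ) : ℚ) = C) (hCW : IsIsogenous C W)
    {r : ℤ} (hr : r ≠ 0)
    (hΔ : (r : ℚ) ^ 12 * C.Δ = ((((-1 : ℤ) ^ (q / 2) * q : ℤ)) : ℚ) ^ 6 * A.Δ) :
    D.c ∣ r * D'.c := by
  have hq : q.Prime := Fact.out
  haveI : NeZero q := ⟨hq.ne_zero⟩
  have hW0 : ∀ n : ℕ, q ∣ n → W.LFunction n = 0 := fun n hn ↦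
    W.LFunction_apply_eq_zero_of_not_good_of_not_mult q hadd.1 hadd.2 hn
  have hcoef : ∀ n : ℕ, cuspCoeff D.f n =
      (quadraticChar (ZMod q)).ringHomComp (Int.castRingHom ℂ) n * cuspCoeff D'.f n := fun n ↦
    cuspCoeff_eq_chi_mul_of_twist_pStar hq2 u hu (LFunction_eq_of_isIsogenous_holds _ _ hCW) hW0 D' D n
  obtain ⟨LC, hLC⟩ := exists_isNeronLatticeOf_holds (C.baseChange ℂ)
  have hrC : ((r : ℚ) : ℂ) ≠ 0 := by exact_mod_cast hr
  have hmem : ∀ z : ℂ,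
      gaussSum ((quadraticChar (ZMod q)).ringHomComp (Int.castRingHom ℂ))
        (ZMod.stdAddChar (N := q)) * z ∈ D'.L.lattice → (r : ℂ) * z ∈ LC.lattice := by
    intro z hz
    rw [neronLattice_mem_iff_of_twist_pStar hq2 u hu hΔ D'.isNeronLattice hLC]
    have e : ((((r : ℚ) : ℂ))⁻¹ * ((r : ℂ) * z)) = z := by
      rw [show (r : ℂ) = ((r : ℚ) : ℂ) by push_cast; rfl, ← mul_assoc, inv_mul_cancel₀ hrC, one_mul]
    rw [e]
    exact hz
  exact maninConstant_dvd_mul_of_charTwist_gamma0 D' D hopt (isQuadratic_quadraticChar_ringHomComp q)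
    (isPrimitive_quadraticChar_ringHomComp q hq2) hN'N hqN hcoef hLC r hmem

/-- **71.A for a CERTIFIED ROOT: `c(D') ∣ r`.**  Root `A` with an `X₀(M)`-datum `D_A`, `|c(D_A)| = 1`;
member `W' ∼ A ⊗ q*` globally minimal, additive at `q`, lattice-optimal `X₀(N)`-datum, `M ∣ N`, `q² ∣ N`;
defect `r`.  Then `c(D') ∣ r`, so `|c(D')| ∈ {1, q}` when `r = ±q` and `|c(D')| = 1` when `r = ±1` (70.C). -/
theorem maninConstant_dvd_defect_of_oddTwist {q : ℕ} [Fact q.Prime] (hq2 : q ≠ 2)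
    {A : WeierstrassCurve ℚ} [A.IsElliptic] {M : ℕ} [NeZero M]
    (DA : ModularParametrizationData A M) (hDA : |DA.maninConstant| = 1)
    {C : WeierstrassCurve ℚ} [C.IsElliptic] [C.IsGloballyMinimal] (u : VariableChange ℚ)
    (hu : u • A.quadraticTwist (((-1 : ℤ) ^ (q / 2) * q : ℤ) : ℚ) = C)
    {r : ℤ} (hr : r ≠ 0) (hΔ : (r : ℚ) ^ 12 * C.Δ = ((((-1 : ℤ) ^ (q / 2) * q : ℤ)) : ℚ) ^ 6 * A.Δ)
    {W' : WeierstrassCurve ℚ} [W'.IsElliptic] [W'.IsGloballyMinimal] {N : ℕ} [NeZero N]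
    (D' : ModularParametrizationData W' N) (hMN : M ∣ N) (hqN : q ^ 2 ∣ N)
    (htw : IsIsogenous W' (A.quadraticTwist (((-1 : ℤ) ^ (q / 2) * q : ℤ) : ℚ)))
    (hadd' : ¬ W'.HasGoodReductionAtPrime q ∧ ¬ W'.HasMultiplicativeReductionAtPrime q)
    (hopt' : ∀ z ∈ D'.L.lattice, ∃ w ∈ periodLattice D'.f, z = D'.c * w) :
    D'.maninConstant ∣ r := by
  have hqP : q.Prime := Fact.out
  have hd0 : ((((-1 : ℤ) ^ (q / 2) * q : ℤ)) : ℚ) ≠ 0 := by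
    push_cast
    exact mul_ne_zero (pow_ne_zero _ (by norm_num)) (by exact_mod_cast hqP.ne_zero)
  haveI : (A.quadraticTwist (((-1 : ℤ) ^ (q / 2) * q : ℤ) : ℚ)).IsElliptic := A.isElliptic_quadraticTwist hd0
  have hCW : IsIsogenous C W' :=
    (isIsogenous_of_smul_eq' hu).trans' (IsIsogenous.symm_of_isElliptic htw)
  exact dvd_of_dvd_mul_of_abs_eq_one
    (maninConstant_dvd_mul_of_oddTwist_defect hq2 D' hopt' DA hMN hqN hadd' u hu hCW hr hΔ) hDA

/-- **THE C2 SHAPE ALONG EVERY ODD TWIST (any alignment).**  In 71.A's root situation with `r = 1 ∨ r = q`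
(UP or DOWN — the only two values of the defect between minimal models): `ℓ ∤ c(D')` for every prime
`ℓ ≠ q`; in particular `2 ∤ c(D')` — the conclusion of crux C2 `ManinOddAtFour` on the member's data when
`4 ∣ N` — and `3 ∤ c(D')` when `q ≠ 3` (the conclusion of C3). -/
theorem not_prime_dvd_maninConstant_of_oddTwist {q : ℕ} [Fact q.Prime] (hq2 : q ≠ 2)
    {A : WeierstrassCurve ℚ} [A.IsElliptic] {M : ℕ} [NeZero M]
    (DA : ModularParametrizationData A M) (hDA : |DA.maninConstant| = 1)
    {C : WeierstrassCurve ℚ} [C.IsElliptic] [C.IsGloballyMinimal] (u : VariableChange ℚ)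
    (hu : u • A.quadraticTwist (((-1 : ℤ) ^ (q / 2) * q : ℤ) : ℚ) = C)
    {r : ℤ} (hr : r = 1 ∨ r = q) (hΔ : (r : ℚ) ^ 12 * C.Δ = ((((-1 : ℤ) ^ (q / 2) * q : ℤ)) : ℚ) ^ 6 * A.Δ)
    {W' : WeierstrassCurve ℚ} [W'.IsElliptic] [W'.IsGloballyMinimal] {N : ℕ} [NeZero N]
    (D' : ModularParametrizationData W' N) (hMN : M ∣ N) (hqN : q ^ 2 ∣ N)
    (htw : IsIsogenous W' (A.quadraticTwist (((-1 : ℤ) ^ (q / 2) * q : ℤ) : ℚ)))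
    (hadd' : ¬ W'.HasGoodReductionAtPrime q ∧ ¬ W'.HasMultiplicativeReductionAtPrime q)
    (hopt' : ∀ z ∈ D'.L.lattice, ∃ w ∈ periodLattice D'.f, z = D'.c * w)
    {ℓ : ℕ} (hℓ : ℓ.Prime) (hℓq : ℓ ≠ q) : ¬ (ℓ : ℤ) ∣ D'.maninConstant := by
  have hqP : q.Prime := Fact.out
  have hr0 : r ≠ 0 := by
    rcases hr with rfl | rfl
    · exact one_ne_zero
    · exact_mod_cast hqP.ne_zero
  have h1 : D'.maninConstant ∣ r :=
    maninConstant_dvd_defect_of_oddTwist hq2 DA hDA u hu hr0 hΔ D' hMN hqN htw hadd' hopt'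
  have h2 : D'.maninConstant ∣ (q : ℤ) := by
    rcases hr with rfl | rfl
    · exact h1.trans (one_dvd _)
    · exact h1
  exact not_prime_dvd_of_dvd_prime hqP hℓ hℓq h2

/-- `2⁴ · N ∣ N³` for `4 ∣ N` (the common level of the `χ₋₄` transport lies inside the radical of `N`). [elementary] -/
theorem two_pow_four_mul_dvd_pow_three {N : ℕ} (h4 : 2 ^ 2 ∣ N) : 2 ^ 4 * N ∣ N ^ (2 + 1) := by
  obtain ⟨t, rfl⟩ := h4; exact ⟨t ^ 2, by ring⟩

/-- **THEOREM 71.B — THE DYADIC DEFECT LAW, LEVEL-FREE, NO NAMED FACT** (`d = ±2`).  `A` globally minimal,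
ADDITIVE at `2`, with ANY `X₀(M)`-datum `D_A`, `4 ∣ M`; `C = u • (A ⊗ d)` globally minimal with defect `r`:
`r¹² Δ(C) = d⁶ Δ(A)`; `W'` globally minimal, ADDITIVE at `2`, `W' ∼ A ⊗ ℚ(√d)`, with a lattice-optimal
`X₀(N)`-datum `D'`, `4 ∣ N`, `M ∣ 2⁶·N` (the root may sit at a lower, the same or a HIGHER `2`-level).
Then `c(D') ∣ r · c(D_A)`.  p2's level-free engine at `L = 2⁶N` with `χ₈ / χ₈′`; additivity DISPLAYED
(no `exists_isNewformOf`).  `r = 1` and `M ∣ N`, `2⁶ ∣ N` is desc g45's 70.B.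
[cite: Stevens1989, Lemma (5.4) p. 97] [cite: Pal2012, Prop. 2.4 (clause d ≡ 2 mod 4), Lemma 3.1] -/
theorem maninConstant_dvd_mul_of_twoTwist_additive_defect {d : ℤ} (hd : d = 2 ∨ d = -2)
    {A : WeierstrassCurve ℚ} [A.IsElliptic] [A.IsGloballyMinimal] {M : ℕ} [NeZero M]
    (DA : ModularParametrizationData A M) (h4M : 4 ∣ M)
    (haddA : ¬ A.HasGoodReductionAtPrime 2 ∧ ¬ A.HasMultiplicativeReductionAtPrime 2)
    {C : WeierstrassCurve ℚ} [C.IsElliptic] [C.IsGloballyMinimal] (u : VariableChange ℚ)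
    (hu : u • A.quadraticTwist (d : ℚ) = C) {r : ℤ} (hΔ : (r : ℚ) ^ 12 * C.Δ = (d : ℚ) ^ 6 * A.Δ)
    {W' : WeierstrassCurve ℚ} [W'.IsElliptic] [W'.IsGloballyMinimal] {N : ℕ} [NeZero N]
    (D' : ModularParametrizationData W' N) (h4N : 2 ^ 2 ∣ N) (hML : M ∣ 2 ^ 6 * N)
    (htw : IsIsogenous W' (A.quadraticTwist (d : ℚ)))
    (hadd' : ¬ W'.HasGoodReductionAtPrime 2 ∧ ¬ W'.HasMultiplicativeReductionAtPrime 2)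
    (hopt' : ∀ z ∈ D'.L.lattice, ∃ w ∈ periodLattice D'.f, z = D'.c * w) :
    D'.c ∣ r * DA.c := by
  haveI : Fact (Nat.Prime 2) := ⟨Nat.prime_two⟩
  haveI : NeZero (2 ^ 6 * N) := ⟨mul_ne_zero (by norm_num) (NeZero.ne N)⟩
  have hdZ : d ≠ 0 := by rcases hd with rfl | rfl <;> norm_num
  have hNL : N ∣ 2 ^ 6 * N := dvd_mul_left N _
  have hLN : 2 ^ 6 * N ∣ N ^ (3 + 1) := maninLocalTwoThree_two_pow_six_mul_dvd_pow_four h4N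
  have hmL : 8 ^ 2 ∣ 2 ^ 6 * N := ⟨N, by norm_num⟩
  rcases hd with rfl | rfl
  · exact maninLocalTwoThree_maninConstant_dvd_mul_of_additiveTwist_of_char_level D' hopt' DA hdZ
      isQuadratic_χ₈_ringHomComp isPrimitive_χ₈_ringHomComp
      (by rw [gaussSum_χ₈_ringHomComp_sq]; norm_num)
      (fun hhalf x ↦ ⟨1, 3, -1, sum_χ₈_modularSymbol_of_half DA.f hhalf x⟩)
      (fun n hn ↦ by
        rw [show ((2 : ℤ) : ℚ) = 2 by norm_num, A.LFunction_quadraticTwist_two_apply_of_odd hn,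
          Int.cast_mul, χ₈_ringHomComp_apply_natCast])
      (fun n hn ↦ by
        rw [χ₈_ringHomComp_apply_natCast, ZMod.χ₈_nat_eq_if_mod_eight,
          if_pos (Nat.mod_eq_zero_of_dvd hn)]
        simp)
      htw u hu hΔ hNL 3 hLN hML hmL h4M haddA hadd'
  · exact maninLocalTwoThree_maninConstant_dvd_mul_of_additiveTwist_of_char_level D' hopt' DA hdZ
      isQuadratic_χ₈'_ringHomComp isPrimitive_χ₈'_ringHomComp
      (by rw [gaussSum_χ₈'_ringHomComp_sq]; norm_num)
      (fun hhalf x ↦ ⟨1, 3, 1, sum_χ₈'_modularSymbol_of_half DA.f hhalf x⟩)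
      (fun n hn ↦ by
        rw [show ((-2 : ℤ) : ℚ) = -2 by norm_num, A.LFunction_quadraticTwist_neg_two_apply_of_odd hn,
          Int.cast_mul, χ₈'_ringHomComp_apply_natCast])
      (fun n hn ↦ by
        rw [χ₈'_ringHomComp_apply_natCast, ZMod.χ₈'_nat_eq_if_mod_eight,
          if_pos (Nat.mod_eq_zero_of_dvd hn)]
        simp)
      htw u hu hΔ hNL 3 hLN hML hmL h4M haddA hadd'

/-- **71.B for a CERTIFIED ROOT: `c(D') ∣ r`** — `|c(D')| = 1` on the ALIGNED members (`r = ±1`: 70.B,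
now LEVEL-FREE) and `c(D') ∣ 2` on the DOWN members (`r = ±2`). -/
theorem maninConstant_dvd_defect_of_twoTwist_additive {d : ℤ} (hd : d = 2 ∨ d = -2)
    {A : WeierstrassCurve ℚ} [A.IsElliptic] [A.IsGloballyMinimal] {M : ℕ} [NeZero M]
    (DA : ModularParametrizationData A M) (hDA : |DA.maninConstant| = 1) (h4M : 4 ∣ M)
    (haddA : ¬ A.HasGoodReductionAtPrime 2 ∧ ¬ A.HasMultiplicativeReductionAtPrime 2)
    {C : WeierstrassCurve ℚ} [C.IsElliptic] [C.IsGloballyMinimal] (u : VariableChange ℚ)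
    (hu : u • A.quadraticTwist (d : ℚ) = C) {r : ℤ} (hΔ : (r : ℚ) ^ 12 * C.Δ = (d : ℚ) ^ 6 * A.Δ)
    {W' : WeierstrassCurve ℚ} [W'.IsElliptic] [W'.IsGloballyMinimal] {N : ℕ} [NeZero N]
    (D' : ModularParametrizationData W' N) (h4N : 2 ^ 2 ∣ N) (hML : M ∣ 2 ^ 6 * N)
    (htw : IsIsogenous W' (A.quadraticTwist (d : ℚ)))
    (hadd' : ¬ W'.HasGoodReductionAtPrime 2 ∧ ¬ W'.HasMultiplicativeReductionAtPrime 2)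
    (hopt' : ∀ z ∈ D'.L.lattice, ∃ w ∈ periodLattice D'.f, z = D'.c * w) :
    D'.maninConstant ∣ r :=
  dvd_of_dvd_mul_of_abs_eq_one
    (maninConstant_dvd_mul_of_twoTwist_additive_defect hd DA h4M haddA u hu hΔ D' h4N hML htw hadd' hopt') hDA

/-- **THE C3 SHAPE ALONG EVERY DYADIC `±8`-TWIST OF A `2`-ADDITIVE ROOT (any alignment), LEVEL-FREE.**
In 71.B's root situation with `r = 1 ∨ r = 2`: `ℓ ∤ c(D')` for every ODD prime `ℓ`; in particular
`3 ∤ c(D')` — the conclusion of crux C3 `ManinPrimeToThreeAtNine` on the member's data when `9 ∣ N`. -/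
theorem not_prime_dvd_maninConstant_of_twoTwist_additive {d : ℤ} (hd : d = 2 ∨ d = -2)
    {A : WeierstrassCurve ℚ} [A.IsElliptic] [A.IsGloballyMinimal] {M : ℕ} [NeZero M]
    (DA : ModularParametrizationData A M) (hDA : |DA.maninConstant| = 1) (h4M : 4 ∣ M)
    (haddA : ¬ A.HasGoodReductionAtPrime 2 ∧ ¬ A.HasMultiplicativeReductionAtPrime 2)
    {C : WeierstrassCurve ℚ} [C.IsElliptic] [C.IsGloballyMinimal] (u : VariableChange ℚ)
    (hu : u • A.quadraticTwist (d : ℚ) = C) {r : ℤ} (hr : r = 1 ∨ r = 2)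
    (hΔ : (r : ℚ) ^ 12 * C.Δ = (d : ℚ) ^ 6 * A.Δ)
    {W' : WeierstrassCurve ℚ} [W'.IsElliptic] [W'.IsGloballyMinimal] {N : ℕ} [NeZero N]
    (D' : ModularParametrizationData W' N) (h4N : 2 ^ 2 ∣ N) (hML : M ∣ 2 ^ 6 * N)
    (htw : IsIsogenous W' (A.quadraticTwist (d : ℚ)))
    (hadd' : ¬ W'.HasGoodReductionAtPrime 2 ∧ ¬ W'.HasMultiplicativeReductionAtPrime 2)
    (hopt' : ∀ z ∈ D'.L.lattice, ∃ w ∈ periodLattice D'.f, z = D'.c * w)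
    {ℓ : ℕ} (hℓ : ℓ.Prime) (hℓ2 : ℓ ≠ 2) : ¬ (ℓ : ℤ) ∣ D'.maninConstant := by
  have h1 : D'.maninConstant ∣ r :=
    maninConstant_dvd_defect_of_twoTwist_additive hd DA hDA h4M haddA u hu hΔ D' h4N hML htw hadd' hopt'
  have h2 : D'.maninConstant ∣ ((2 : ℕ) : ℤ) := by
    rcases hr with rfl | rfl
    · exact h1.trans (one_dvd _)
    · exact_mod_cast h1
  exact not_prime_dvd_of_dvd_prime Nat.prime_two hℓ hℓ2 h2

/-- **THEOREM 71.C — `χ₋₄`-PROPAGATION OF `|c| = 1` FROM A `2`-ADDITIVE ROOT, LEVEL-FREE, NO NAMED FACT.**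
As desc g45's 70.A (`r = 1` by Connell–Pal, no clause) but with `M ∣ N ∧ 2⁴ ∣ N` replaced by `4 ∣ N ∧ M ∣ 2⁴·N`:
the root may sit at a HIGHER `2`-level than the member (census v3: the `49` `χ₋₄` steps illegal only for the
level, e.g. `48a → 24a`, `64a`'s `χ₋₄·t` members at `2⁵`). Common level `L = 2⁴N ∣ N³`.
[cite: Stevens1989, Lemma (5.4) p. 97] [cite: Pal2012, Prop. 2.4 (Connell), Lemma 3.1] [cite: Connell1999, §5.7.3] -/
theorem abs_maninConstant_eq_one_of_negOneTwist_additive_levelFree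
    {A : WeierstrassCurve ℚ} [A.IsElliptic] [A.IsGloballyMinimal] {M : ℕ} [NeZero M]
    (DA : ModularParametrizationData A M) (hDA : |DA.maninConstant| = 1) (h4M : 4 ∣ M)
    (haddA : ¬ A.HasGoodReductionAtPrime 2 ∧ ¬ A.HasMultiplicativeReductionAtPrime 2)
    {W' : WeierstrassCurve ℚ} [W'.IsElliptic] [W'.IsGloballyMinimal] {N : ℕ} [NeZero N]
    (D' : ModularParametrizationData W' N) (h4N : 2 ^ 2 ∣ N) (hML : M ∣ 2 ^ 4 * N)
    (htw : IsIsogenous W' (A.quadraticTwist ((-1 : ℤ) : ℚ)))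
    (hadd' : ¬ W'.HasGoodReductionAtPrime 2 ∧ ¬ W'.HasMultiplicativeReductionAtPrime 2)
    (hopt' : ∀ z ∈ D'.L.lattice, ∃ w ∈ periodLattice D'.f, z = D'.c * w) :
    |D'.maninConstant| = 1 := by
  haveI : Fact (Nat.Prime 2) := ⟨Nat.prime_two⟩
  haveI : NeZero (2 ^ 4 * N) := ⟨mul_ne_zero (by norm_num) (NeZero.ne N)⟩
  have hd0 : ((-1 : ℤ) : ℚ) ≠ 0 := by norm_num
  haveI : (A.quadraticTwist ((-1 : ℤ) : ℚ)).IsElliptic := A.isElliptic_quadraticTwist hd0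
  -- a minimal model `C` of `A ⊗ (−1)`; it is isogenous to `W'`, hence ADDITIVE at `2` (fact-free, §0)
  obtain ⟨vC, hvC⟩ := hasGlobalMinimalModel_rat_holds (A.quadraticTwist ((-1 : ℤ) : ℚ))
  haveI := hvC
  have hCW : IsIsogenous (vC • A.quadraticTwist ((-1 : ℤ) : ℚ)) W' :=
    (isIsogenous_of_smul (A.quadraticTwist ((-1 : ℤ) : ℚ)) vC).trans' (IsIsogenous.symm_of_isElliptic htw)
  have haddC : ¬ (vC • A.quadraticTwist ((-1 : ℤ) : ℚ)).HasGoodReductionAtPrime 2 ∧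
      ¬ (vC • A.quadraticTwist ((-1 : ℤ) : ℚ)).HasMultiplicativeReductionAtPrime 2 :=
    not_good_and_not_mult_of_isIsogenous hCW 2 hadd'
  have h4A : 2 ^ 2 ∣ A.conductorNorm ℤ := sq_dvd_conductorNorm_of_not_good_of_not_mult haddA
  have h4C : 2 ^ 2 ∣ (vC • A.quadraticTwist ((-1 : ℤ) : ℚ)).conductorNorm ℤ :=
    sq_dvd_conductorNorm_of_not_good_of_not_mult haddC
  -- Connell–Pal: `Δ(C) = Δ(A)`, i.e. defect `r = 1`
  have hΔC : (vC • A.quadraticTwist ((-1 : ℤ) : ℚ)).Δ = A.Δ :=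
    connellPal_Δ_eq_of_negOne_twist_of_four_dvd_conductor_holds A _ vC h4A h4C rfl
  have hΔ : ((1 : ℤ) : ℚ) ^ 12 * (vC • A.quadraticTwist ((-1 : ℤ) : ℚ)).Δ =
      (((-1 : ℤ) : ℚ)) ^ 6 * A.Δ := by
    rw [hΔC]; norm_num
  -- the common level `L = 2⁴ N`
  have hNL : N ∣ 2 ^ 4 * N := dvd_mul_left N _
  have hLN : 2 ^ 4 * N ∣ N ^ (2 + 1) := two_pow_four_mul_dvd_pow_three h4N
  have hmL : 4 ^ 2 ∣ 2 ^ 4 * N := ⟨N, by norm_num⟩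
  have hdvd : D'.c ∣ 1 * DA.c :=
    maninLocalTwoThree_maninConstant_dvd_mul_of_additiveTwist_of_char_level D' hopt' DA (d := -1)
      (by norm_num) isQuadratic_χ₄_ringHomComp isPrimitive_χ₄_ringHomComp
      (by rw [gaussSum_χ₄_ringHomComp_sq]; norm_num)
      (fun hhalf x ↦ ⟨1, 3, 0, sum_χ₄_modularSymbol_of_half DA.f hhalf x⟩)
      (fun n hn ↦ by
        rw [show ((-1 : ℤ) : ℚ) = -1 by norm_num, A.LFunction_quadraticTwist_neg_one_apply_of_odd hn,
          Int.cast_mul, χ₄_ringHomComp_apply_natCast])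
      (fun n hn ↦ by
        rw [χ₄_ringHomComp_apply_natCast, ZMod.χ₄_nat_eq_if_mod_four, if_pos (Nat.mod_eq_zero_of_dvd hn)]
        simp)
      htw vC rfl hΔ hNL 2 hLN hML hmL h4M haddA hadd'
  rw [one_mul] at hdvd
  exact abs_eq_one_of_dvd_of_abs_eq_one hdvd hDA


end Summit.BirchSwinnertonDyer.BirchSwinnertonDyer.Theorems.ManinLocalTwoThree.TwistDefect

end
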